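import Summits.AnomalousDissipation.AnomalousDissipation.Theorems.SolenoidalFractalHomogenisationLagrangianStepWCrossingWindow
import HarnessLib

/-!
# K1L `LagrangianRenormalisationStep(Design)` (K1L_D, stmt-AnomalousDissipation-27980), obligation `stub_D1_exactFamily` — the OFF-WINDOW branch of the
# named family `ΨB`: a zero residue is `RelSmall` for every budget on transversely non-negative tensors (helper; `--supports … --as helper`)

Summits-side helper file of route `SolenoidalFractalHomogenisation` (prover seat `ad-sawtooth-k1loc-p1` g12; sizing memo v2 §3, tenure constraint (β):
the D1 family is defined piecewise in `ν`, `ΨB a ν := exact family on (0, ν₁]`, `:= ΦB a` elsewhere, where clause (i) must then hold with residue `0`).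
`relSmall_zero` — `RelSmall 0 A ρ` for every `ρ` when `A` is transversely non-negative; `relSmall_self_sub` — `RelSmall (Φ S − Φ S) (Φ S) ρ`;
`transNonneg_smul`.  (The window instance for `ΦB a S = a • excQS … S` follows wherever `TransNonneg (excQS … S)` is available, e.g. from the pinch.)
Everything PROVED, no definition, no named fact, no sorry.  NOT a proof of the stub; rung leaf F-D1.A0.
-/

set_option linter.dupNamespace false

noncomputable section

namespace Summit.AnomalousDissipation.AnomalousDissipation.Theorems.SolenoidalFractalHomogenisation.LagrangianStep.WCrossing

open Literature.Analysis Literature.Analysis.FluidPDE Literature.Analysis.FunctionSpaces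

/-- **A zero residue is `RelSmall` for every budget** on a transversely non-negative tensor: `RelSmall 0 A ρ`. [folklore] -/
theorem relSmall_zero {A : T4} (hA : TransNonneg A) (ρ : ℝ) : RelSmall 0 A ρ := by
  intro k p q hp hq
  rw [Torus.bsymb_zero]
  have h := mul_nonneg (mul_nonneg (sq_nonneg ρ) (hA k p hp)) (hA k q hq)
  nlinarith [h]

/-- The residue of a map against itself is `RelSmall` for every budget (transversely non-negative image). [folklore] -/
theorem relSmall_self_sub {Φ : T4 → T4} {S : T4} (hA : TransNonneg (Φ S)) (ρ : ℝ) : RelSmall (Φ S - Φ S) (Φ S) ρ := by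
  rw [sub_self]; exact relSmall_zero hA ρ

/-- `TransNonneg` is preserved by non-negative scaling. [folklore] -/
theorem transNonneg_smul {A : T4} (hA : TransNonneg A) {a : ℝ} (ha : 0 ≤ a) : TransNonneg (a • A) := by
  intro k p hp
  rw [Torus.symb_smul]
  exact mul_nonneg ha (hA k p hp)

end Summit.AnomalousDissipation.AnomalousDissipation.Theorems.SolenoidalFractalHomogenisation.LagrangianStep.WCrossing
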